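import Literature.NumberTheory.Sieve.GoldstonGrahamPintzYildirim
import Literature.NumberTheory.Sieve.PolynomialCongruencesProofs
import Literature.NumberTheory.Sieve.PolynomialCongruencesRootDensity
import HarnessLib

/-!
# The GGPY weight attached to the root count of an irreducible polynomial

Solo informed line (Parity / Bateman–Horn), session 136.  For `g ∈ ℤ[X]` and `m ∈ ℕ` the weight
`γ_{g,m}(p) = p ρ_g(p)/(p + ρ_g(p))` off the primes dividing `m`, `0` on them (`rootGamma`), is
the one for which the multiplicative function of Goldston–Graham–Pintz–Yıldırım's Lemma 3,
`g_γ(d) = ∏_{p ∣ d} γ(p)/(p − γ(p))`, equals `ρ_g(d)/d · 1_{(d,m)=1}` on squarefree `d`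
(`g_rootGamma_of_squarefree_of_coprime`, `g_rootGamma_of_not_coprime`; multiplicativity of `ρ_g`
from the tree's `polyRootCountMod_eq_prod_primeFactors`).  Hence the lemma's sum
`∑_{d < x+1} μ²(d) g_γ(d)` is the squarefree level
`polySqfreeLevel g m x = ∑_{d ≤ x, μ²(d)=1, (d,m)=1} ρ_g(d)/d` (`moebiusSqGSum_rootGamma`), and
hypothesis `(Ω₁)` holds with `A₁ = (deg g + 2)/2` for irreducible `g` of positive degree, from
`ρ_g(p) ≤ deg g` (`hypOmega1_rootGamma`).  The constant `c_{g,m}` is `rootDensityConst g m`.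
Hypothesis `(Ω₂)` and the application of the lemma are in
`SoloInformedRootCountSquarefreeLevel.lean`.
-/

noncomputable section

open Finset Real Polynomial Filter Topology

namespace Summit.Parity.BatemanHorn.Theorems

open Literature.NumberTheory.Sieve

/-! ### The weight `γ_{g,m}` and the squarefree level -/

/-- `γ_{g,m}(p) = p ρ_g(p)/(p + ρ_g(p))` if `p ∤ m`, and `0` if `p ∣ m`. [this work] -/
def rootGamma (g : ℤ[X]) (m : ℕ) (p : ℕ) : ℝ :=
  if p ∣ m then 0 else
    (p : ℝ) * (polyRootCountMod ![g] p : ℝ) / ((p : ℝ) + (polyRootCountMod ![g] p : ℝ))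

/-- The squarefree level coprime to `m`: `∑_{d ≤ x, μ²(d) = 1, (d, m) = 1} ρ_g(d)/d`.
[this work] -/
def polySqfreeLevel (g : ℤ[X]) (m x : ℕ) : ℝ :=
  ∑ d ∈ (Icc 1 x).filter (fun d => Squarefree d ∧ d.Coprime m), (polyRootCountMod ![g] d : ℝ) / d

/-- The constant `c_{g,m} = ∏_p (1 − γ_{g,m}(p)/p)⁻¹ (1 − 1/p)` (GGPY's `c_γ`). [this work] -/
def rootDensityConst (g : ℤ[X]) (m : ℕ) : ℝ := GGPY.cGamma (rootGamma g m)

section Gamma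

variable (g : ℤ[X]) (m : ℕ)

/-- `γ_{g,m}(p) = 0` for `p ∣ m`. [this work] -/
theorem rootGamma_of_dvd {p : ℕ} (h : p ∣ m) : rootGamma g m p = 0 := if_pos h

/-- `γ_{g,m}(p) = pρ_g(p)/(p + ρ_g(p))` for `p ∤ m`. [this work] -/
theorem rootGamma_of_not_dvd {p : ℕ} (h : ¬ p ∣ m) :
    rootGamma g m p =
      (p : ℝ) * (polyRootCountMod ![g] p : ℝ) / ((p : ℝ) + (polyRootCountMod ![g] p : ℝ)) :=
  if_neg h

/-- `γ_{g,m} ≥ 0`. [this work] -/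
theorem rootGamma_nonneg (p : ℕ) : 0 ≤ rootGamma g m p := by
  unfold rootGamma
  split_ifs
  · exact le_rfl
  · positivity

/-- `γ_{g,m}(p) ≤ γ_{g,1}(p)`. [this work] -/
theorem rootGamma_le_rootGamma_one (p : ℕ) : rootGamma g m p ≤ rootGamma g 1 p := by
  by_cases h1 : p ∣ 1
  · have hp : p = 1 := Nat.dvd_one.1 h1
    subst hp
    rw [rootGamma_of_dvd g m (one_dvd m), rootGamma_of_dvd g 1 (one_dvd 1)]
  · rw [rootGamma_of_not_dvd g 1 h1]
    unfold rootGamma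
    split_ifs
    · positivity
    · exact le_rfl

/-- `γ_{g,m}(p)/p = ρ_g(p)/(p + ρ_g(p))` for `p ∤ m`. [this work] -/
theorem rootGamma_div_self_of_not_dvd {p : ℕ} (hp : 0 < p) (h : ¬ p ∣ m) :
    rootGamma g m p / p =
      (polyRootCountMod ![g] p : ℝ) / ((p : ℝ) + (polyRootCountMod ![g] p : ℝ)) := by
  rw [rootGamma_of_not_dvd g m h]
  have hp' : (0 : ℝ) < p := by exact_mod_cast hp
  have hs : (0 : ℝ) < (p : ℝ) + (polyRootCountMod ![g] p : ℝ) := by positivity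
  field_simp

/-- `p − γ_{g,m}(p) = p²/(p + ρ_g(p))` for `p ∤ m`. [this work] -/
theorem sub_rootGamma_of_not_dvd {p : ℕ} (hp : 0 < p) (h : ¬ p ∣ m) :
    (p : ℝ) - rootGamma g m p = (p : ℝ) ^ 2 / ((p : ℝ) + (polyRootCountMod ![g] p : ℝ)) := by
  rw [rootGamma_of_not_dvd g m h]
  have hs : (0 : ℝ) < (p : ℝ) + (polyRootCountMod ![g] p : ℝ) := by positivity
  field_simp
  ring

/-- `γ(p)/(p − γ(p)) = ρ_g(p)/p` off the primes dividing `m`. [this work] -/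
theorem rootGamma_div_sub_of_not_dvd {p : ℕ} (hp : 0 < p) (h : ¬ p ∣ m) :
    rootGamma g m p / ((p : ℝ) - rootGamma g m p) = (polyRootCountMod ![g] p : ℝ) / p := by
  rw [sub_rootGamma_of_not_dvd g m hp h, rootGamma_of_not_dvd g m h]
  have hp' : (0 : ℝ) < p := by exact_mod_cast hp
  have hs : (0 : ℝ) < (p : ℝ) + (polyRootCountMod ![g] p : ℝ) := by positivity
  field_simp

/-- `γ(p)/(p − γ(p)) = 0` on the primes dividing `m`. [this work] -/
theorem rootGamma_div_sub_of_dvd {p : ℕ} (h : p ∣ m) :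
    rootGamma g m p / ((p : ℝ) - rootGamma g m p) = 0 := by
  rw [rootGamma_of_dvd g m h, zero_div]

/-! ### `g_γ` on squarefree numbers -/

/-- `g_γ(d) = ∏_{p ∣ d} (ρ_g(p)/p · 1_{p ∤ m})`. [this work] -/
theorem g_rootGamma_eq_prod (d : ℕ) :
    GGPY.g (rootGamma g m) d =
      ∏ p ∈ d.primeFactors, (if p ∣ m then (0 : ℝ) else (polyRootCountMod ![g] p : ℝ) / p) := by
  unfold GGPY.g
  refine Finset.prod_congr rfl fun p hp => ?_
  have hpp := Nat.prime_of_mem_primeFactors hp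
  split_ifs with h
  · exact rootGamma_div_sub_of_dvd g m h
  · exact rootGamma_div_sub_of_not_dvd g m hpp.pos h

/-- Multiplicativity on squarefree `d`: `ρ_g(d)/d = ∏_{p ∣ d} ρ_g(p)/p`. [this work] -/
theorem cast_polyRootCountMod_div_eq_prod {d : ℕ} (hd : Squarefree d) :
    (polyRootCountMod ![g] d : ℝ) / d =
      ∏ p ∈ d.primeFactors, (polyRootCountMod ![g] p : ℝ) / p := by
  have hd0 : d ≠ 0 := hd.ne_zero
  have h1 : polyRootCountMod ![g] d = ∏ p ∈ d.primeFactors, polyRootCountMod ![g] p := by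
    rw [polyRootCountMod_eq_prod_primeFactors g hd0]
    refine Finset.prod_congr rfl fun p hp => ?_
    have hle := (Nat.squarefree_iff_factorization_le_one hd0).1 hd p
    have hpos : 0 < d.factorization p :=
      (Nat.prime_of_mem_primeFactors hp).factorization_pos_of_dvd hd0
        (Nat.dvd_of_mem_primeFactors hp)
    have : d.factorization p = 1 := le_antisymm hle hpos
    rw [this, pow_one]
  have h2 : (d : ℝ) = ∏ p ∈ d.primeFactors, (p : ℝ) := by
    rw [← Nat.cast_prod, Nat.prod_primeFactors_of_squarefree hd]
  rw [h1, h2, Nat.cast_prod, ← Finset.prod_div_distrib]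

/-- `g_γ(d) = ρ_g(d)/d` for squarefree `d` coprime to `m`. [this work] -/
theorem g_rootGamma_of_squarefree_of_coprime {d : ℕ} (hd : Squarefree d) (hdm : d.Coprime m) :
    GGPY.g (rootGamma g m) d = (polyRootCountMod ![g] d : ℝ) / d := by
  rw [g_rootGamma_eq_prod, cast_polyRootCountMod_div_eq_prod g hd]
  refine Finset.prod_congr rfl fun p hp => ?_
  have hpd : p ∣ d := Nat.dvd_of_mem_primeFactors hp
  have hpp := Nat.prime_of_mem_primeFactors hp
  have hpm : ¬ p ∣ m := fun h => hpp.ne_one (Nat.eq_one_of_dvd_coprimes hdm hpd h)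
  rw [if_neg hpm]

/-- `g_γ(d) = 0` for `d ≠ 0` not coprime to `m`. [this work] -/
theorem g_rootGamma_of_not_coprime {d : ℕ} (hd : d ≠ 0) (hdm : ¬ d.Coprime m) :
    GGPY.g (rootGamma g m) d = 0 := by
  rw [g_rootGamma_eq_prod]
  obtain ⟨p, hp, hpd, hpm⟩ := Nat.Prime.not_coprime_iff_dvd.1 hdm
  exact Finset.prod_eq_zero (Nat.mem_primeFactors.2 ⟨hp, hpd, hd⟩) (if_pos hpm)

/-- The GGPY sum of `γ_{g,m}` below `x + 1` is the squarefree level. [this work] -/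
theorem moebiusSqGSum_rootGamma (x : ℕ) :
    GGPY.moebiusSqGSum (rootGamma g m) ((x : ℝ) + 1) = polySqfreeLevel g m x := by
  unfold GGPY.moebiusSqGSum polySqfreeLevel
  have hceil : ⌈(x : ℝ) + 1⌉₊ = x + 1 := by
    have : (x : ℝ) + 1 = ((x + 1 : ℕ) : ℝ) := by push_cast; ring
    rw [this, Nat.ceil_natCast]
  rw [hceil, Finset.Ico_add_one_right_eq_Icc, Finset.sum_filter]
  refine Finset.sum_congr rfl fun d hd => ?_
  have hd0 : d ≠ 0 := by
    have := (Finset.mem_Icc.1 hd).1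
    omega
  by_cases hsq : Squarefree d
  · have hμ : ((ArithmeticFunction.moebius d : ℤ) : ℝ) ^ 2 = 1 := by
      have := ArithmeticFunction.moebius_sq_eq_one_of_squarefree hsq
      exact_mod_cast this
    rw [hμ, one_mul]
    by_cases hc : d.Coprime m
    · rw [if_pos ⟨hsq, hc⟩, g_rootGamma_of_squarefree_of_coprime g m hsq hc]
    · rw [if_neg (fun h => hc h.2), g_rootGamma_of_not_coprime g m hd0 hc]
  · rw [ArithmeticFunction.moebius_eq_zero_of_not_squarefree hsq, if_neg (fun h => hsq h.1)]
    simp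

end Gamma

/-! ### Hypothesis `(Ω₁)` -/

/-- `(Ω₁)` for `γ_{g,m}` with `A₁ = (deg g + 2)/2`. [this work] -/
theorem hypOmega1_rootGamma {g : ℤ[X]} (hirr : Irreducible g) (hdeg : 0 < g.natDegree) (m : ℕ) :
    GGPY.HypOmega1 (rootGamma g m) (((g.natDegree : ℝ) + 2) / 2) := by
  intro p hp
  set n : ℝ := (g.natDegree : ℝ) with hn
  have hn1 : (1 : ℝ) ≤ n := by rw [hn]; exact_mod_cast hdeg
  have hA : (1 : ℝ) - 1 / ((n + 2) / 2) = n / (n + 2) := by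
    field_simp
    ring
  rw [hA]
  by_cases h : p ∣ m
  · rw [rootGamma_of_dvd g m h, zero_div]
    exact ⟨le_rfl, by positivity⟩
  · rw [rootGamma_div_self_of_not_dvd g m hp.pos h]
    set ρ : ℝ := (polyRootCountMod ![g] p : ℝ) with hρ
    have hρ0 : 0 ≤ ρ := Nat.cast_nonneg _
    have hρn : ρ ≤ n := by
      rw [hρ, hn]
      exact_mod_cast polyRootCountMod_prime_le_natDegree_of_irreducible hirr hdeg hp
    have hp2 : (2 : ℝ) ≤ p := by exact_mod_cast hp.two_le
    refine ⟨by positivity, ?_⟩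
    rw [div_le_div_iff₀ (by positivity) (by positivity)]
    nlinarith [mul_le_mul_of_nonneg_right hp2 (by positivity : (0 : ℝ) ≤ n)]

end Summit.Parity.BatemanHorn.Theorems
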